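import Literature.NumberTheory.Transcendental.RoySmallValueStep2Select
import Literature.NumberTheory.Transcendental.RoySmallValueLevels
import Literature.NumberTheory.Transcendental.RoySmallValueProp61
import Literature.NumberTheory.Transcendental.RoySmallValueVanishing
import Literature.NumberTheory.Transcendental.NesterenkoEliminationCor410Proofs
import Literature.NumberTheory.Transcendental.RoySmallValueDistanceLower
import Literature.NumberTheory.Transcendental.RoySmallValueStepsGlue
import HarnessLib

/-!
# Roy's small value estimate for `𝔾ₐ × 𝔾ₘ` — Step 2 at one degree: the convex body `𝒞_D` and the selected orbit

Topic `Literature/NumberTheory/Transcendental`. Part of the formalisation of the proof of Roy 2013,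
Theorem 1.1 (named fact `roy2013_thm_1_1`, `RoySmallValueEstimates.lean`). Source: D. Roy,
*A small value estimate for `𝔾ₐ × 𝔾ₘ`*, Mathematika 59 (2013) 333–363 = arXiv:1301.0663, §6
(Prop. 6.1, 6.2) and §7, Steps 1–2 (pp. 15–18 of the arXiv text):

> `𝒞 = { P ∈ ℂ[X]_D ; ‖P‖ ≤ e^Y, max_{0 ≤ i < T} |𝒟ⁱP(1,ξ,η)| ≤ e^{−U} }` [...]
> we have `h_𝒞(ℙ²) ≤ −TU + 3D²Y + 21 log(3) D³`. [...] Thus, there exists a `0`-dimensional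
> subvariety `Z = Z_D` of `ℙ²_ℚ` contained in `𝒵(𝒟ⁱP̃_D ; 0 ≤ i < 2T)` such that
> `h_{𝒞_D}(Z) ≤ −(D^δ/25)(2D^β deg(Z) + D h(Z))`.

We define Roy's convex body `𝒞 = bodyC D T ξ η Y U` (a set of forms of degree `D`), check that it
is convex in Roy's sense (`bodyC_convex`) and bound `Φ(P̃, Q, ·)` on it by Proposition 6.1
(`norm_royPhi_le_of_mem_bodyC`, for `P̃, Q ∈ 𝒞`). Feeding this into the selection of an orbit
(`step2_select`) for the data `LevelPkg` of the degree gives the level form of Proposition 6.2 /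
Step 2 (`step2_level`): an orbit `O` of normalised representatives of `𝒵(P̃, Q)` such that every
family of test forms in `𝒞` indexed by `O` has small weighted product, and consequently
(`vanish_on_orbit`) every INTEGER form of `𝒞` vanishes on `O`. All side conditions are explicit
numerical hypotheses (discharged asymptotically in the final assembly). Everything is proved; one
definition (`bodyC`); no named facts.

## References

* [Roy2013] D. Roy, *A small value estimate for 𝔾ₐ × 𝔾ₘ*, Mathematika 59 (2013), 333–363
  (arXiv:1301.0663), Propositions 6.1, 6.2 and §7, Step 2.

## Part 2 — the test forms of §4 in the convex body (former `RoySmallValueTestForms`)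


Topic `Literature/NumberTheory/Transcendental`. Part of the formalisation of the proof of Roy 2013,
Theorem 1.1 (named fact `roy2013_thm_1_1`, `RoySmallValueEstimates.lean`). Source: D. Roy,
*A small value estimate for `𝔾ₐ × 𝔾ₘ`*, Mathematika 59 (2013) 333–363 = arXiv:1301.0663, §7,
Step 2 (p. 18 of the arXiv text):

> `sup{|P(α)| ; P ∈ 𝒞_D} ≥ sup{|P(α)| ; P ∈ I_D^{(γ,T)}, ‖P‖ ≤ 1} = |I_D^{(γ,T)}|_α`. [...]
> For each `α ∈ Z(ℂ) ∖ 𝒰`, Proposition 4.5 gives `|I_D^{(γ,T)}|_α ≥ … ≥ T^{−7T log T}` [...]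
> For the more interesting points `α ∈ 𝒰`, it gives
> `|I_D^{(γ,T)}|_α ≥ T^{−7T log T} max{dist(α,(1:γ))^T, dist(α, A_γ)}` [...]

For a point `α` (representative of sup norm `≤ 1` with a coordinate of modulus `1`) we produce
TEST FORMS in Roy's convex body `𝒞 = bodyC D T ξ η Y U` — normalised elements of
`I_D^{(γ,T)}` given by Proposition 4.5 (i), (ii) (`RoySmallValueDistanceLower`) — whose value at
`α` is bounded BELOW: `exists_testForm_pdist` (`log|t(α)| ≥ T log dist(α,(1:γ)) − k log C₁`,
any `α`) and `exists_testForm_max` (`log|t(α)| ≥ max{T log dist(α,(1:γ)), log dist(α,A_γ)} − E₂`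
for `α ∈ 𝒰`, with the convention that the second entry of the `max` is any number
`≤ T log dist(α,(1:γ))` when `dist(α, A_γ) = 0`). The error terms `errC₁`, `errU` are explicit.
Everything is proved; the definitions are the explicit constants; no named facts.

## References

* [Roy2013] D. Roy, *A small value estimate for 𝔾ₐ × 𝔾ₘ*, Mathematika 59 (2013), 333–363
  (arXiv:1301.0663), §7, Step 2 and Proposition 4.5.

## Part 3 — the sum over `𝒰` (former `RoySmallValueStep2Sums`)


Topic `Literature/NumberTheory/Transcendental`. Part of the formalisation of the proof of Roy 2013,
Theorem 1.1 (named fact `roy2013_thm_1_1`, `RoySmallValueEstimates.lean`). Source: D. Roy,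
*A small value estimate for `𝔾ₐ × 𝔾ₘ`*, Mathematika 59 (2013) 333–363 = arXiv:1301.0663, §7,
Step 2 (p. 18 of the arXiv text):

> Putting all these estimates together, taking into account that `Z(ℂ)` consists of `deg(Z)`
> points, we conclude that
> `∑_{α ∈ 𝒰} max{T log dist(α,(1:γ)), log dist(α,A_γ)} ≤ ∑_{α∈Z} log|I_D^{(γ,T)}|_α + 7T(log T)² deg(Z)`
> `≤ −(D^δ/25)(D^β deg(Z) + D h(Z))` [...]

Given an orbit `O` of points `α_j` (normalised representatives, `RoySmallValueOrbitsK`) with the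
conclusion of Step 2 in product form — every family `(t_j)_{j∈O}` of elements of the convex body
`𝒞` has `∏_{j∈O} |t_j(α_j^u)| e^{D h_j} ≤ Θ` (`α^u = α/‖α‖`, `RoySmallValueStep2Level`) — we
choose the test forms of `RoySmallValueTestForms` point by point and derive the displayed
inequality (`step2_sums`):

  `∑_{j ∈ 𝒰} max{T log dist(α_j^u,(1:γ)), b_j} ≤ log Θ + E · #O`,

`𝒰 = {j ∈ O ; dist(α_j^u,(1:γ)) ≤ (2c₂)⁻¹}`, `b_j = log dist(α_j^u, A_γ)` (with the convention of
`exists_testForm_max` when this distance vanishes), `E` explicit (`errStep2`). The bookkeeping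
"putting all these estimates together" is the tree's `sum_filter_le_sum_add` (seat B). Everything
is proved; the definitions (`unitRep`, `errStep2`) have bodies; no named facts.

## References

* [Roy2013] D. Roy, *A small value estimate for 𝔾ₐ × 𝔾ₘ*, Mathematika 59 (2013), 333–363
  (arXiv:1301.0663), §7, Step 2.
-/

noncomputable section

open MvPolynomial Finset NumberField Height

namespace Literature.NumberTheory.Transcendental

namespace Roy2013

open Nesterenko

/-! ### The convex body `𝒞` -/

/-- **Roy's convex body** `𝒞 = {P ∈ ℂ[X]_D ; ‖P‖ ≤ e^Y, max_{i<T} |𝒟ⁱP(1,ξ,η)| ≤ e^{−U}}`.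
[cite: Roy2013, Proposition 6.1] -/
def bodyC (D T : ℕ) (ξ η : ℂ) (Y U : ℝ) : Set CX :=
  {R | R.IsHomogeneous D ∧ maxNorm R ≤ Real.exp Y ∧
    ∀ i < T, ‖aeval ![1, ξ, η] (homD^[i] R)‖ ≤ Real.exp (-U)}

variable {D T : ℕ} {ξ η : ℂ} {Y U : ℝ}

/-- Membership. [folklore] -/
theorem mem_bodyC {R : CX} : R ∈ bodyC D T ξ η Y U ↔ R.IsHomogeneous D ∧ maxNorm R ≤ Real.exp Y ∧
    ∀ i < T, ‖aeval ![1, ξ, η] (homD^[i] R)‖ ≤ Real.exp (-U) := Iff.rfl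

/-- `0 ∈ 𝒞`. [folklore] -/
theorem zero_mem_bodyC : (0 : CX) ∈ bodyC D T ξ η Y U := by
  refine ⟨isHomogeneous_zero _ _ _, by rw [maxNorm_zero]; exact (Real.exp_pos _).le, fun i _ => ?_⟩
  rw [Function.iterate_fixed (map_zero homD) i, map_zero, norm_zero]
  exact (Real.exp_pos _).le

/-- **`𝒞` is a convex body in Roy's sense**: `λR + μS ∈ 𝒞` for `R, S ∈ 𝒞`, `|λ| + |μ| ≤ 1`.
[cite: Roy2013, §2 ("`λP + μQ ∈ 𝒞`")] -/
theorem bodyC_convex : ∀ R ∈ bodyC D T ξ η Y U, ∀ S ∈ bodyC D T ξ η Y U, ∀ a b : ℂ,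
    ‖a‖ + ‖b‖ ≤ 1 → a • R + b • S ∈ bodyC D T ξ η Y U := by
  intro R hR S hS a b hab
  obtain ⟨hRh, hRn, hRv⟩ := hR
  obtain ⟨hSh, hSn, hSv⟩ := hS
  refine ⟨?_, ?_, fun i hi => ?_⟩
  · have h1 : (a • R).IsHomogeneous D := by
      rw [smul_eq_C_mul]; simpa using (isHomogeneous_C _ a).mul hRh
    have h2 : (b • S).IsHomogeneous D := by
      rw [smul_eq_C_mul]; simpa using (isHomogeneous_C _ b).mul hSh
    exact h1.add h2
  · rw [smul_eq_C_mul, smul_eq_C_mul]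
    refine (maxNorm_add_le _ _).trans ?_
    refine (add_le_add (maxNorm_C_mul_le a R) (maxNorm_C_mul_le b S)).trans ?_
    calc ‖a‖ * maxNorm R + ‖b‖ * maxNorm S ≤ ‖a‖ * Real.exp Y + ‖b‖ * Real.exp Y :=
          add_le_add (mul_le_mul_of_nonneg_left hRn (norm_nonneg _))
            (mul_le_mul_of_nonneg_left hSn (norm_nonneg _))
      _ = (‖a‖ + ‖b‖) * Real.exp Y := by ring
      _ ≤ 1 * Real.exp Y := mul_le_mul_of_nonneg_right hab (Real.exp_pos _).le
      _ = Real.exp Y := one_mul _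
  · rw [iterate_homD_add, iterate_homD_smul, iterate_homD_smul, map_add, map_smul, map_smul]
    refine (norm_add_le _ _).trans ?_
    rw [norm_smul, norm_smul]
    calc ‖a‖ * ‖aeval ![1, ξ, η] (homD^[i] R)‖ + ‖b‖ * ‖aeval ![1, ξ, η] (homD^[i] S)‖
        ≤ ‖a‖ * Real.exp (-U) + ‖b‖ * Real.exp (-U) :=
          add_le_add (mul_le_mul_of_nonneg_left (hRv i hi) (norm_nonneg _))
            (mul_le_mul_of_nonneg_left (hSv i hi) (norm_nonneg _))
      _ = (‖a‖ + ‖b‖) * Real.exp (-U) := by ring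
      _ ≤ 1 * Real.exp (-U) := mul_le_mul_of_nonneg_right hab (Real.exp_pos _).le
      _ = Real.exp (-U) := one_mul _

/-! ### `Φ` on `𝒞` (Proposition 6.1) -/

variable {M₁ M₂ : Finset (Fin 3 →₀ ℕ)}

/-- **`sup_𝒞 |Φ(P̃, Q, ·)| ≤ e^{−TU} N! (3e^Y)^N`** for `P̃, Q ∈ 𝒞` (Proposition 6.1 with the first
two arguments fixed). [cite: Roy2013, Proposition 6.1 and §7, Step 2] -/
theorem norm_royPhi_le_of_mem_bodyC (hη : η ≠ 0) {L : ℕ} (hTL : T ≤ (L + 2).choose 2)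
    (hLD : L ≤ D) (hU : 0 ≤ U)
    (hY : (3 * (1 + ‖ξ‖ + ‖η‖⁻¹)) ^ L * (4 * (L + 1) : ℝ) ^ (L + 2).choose 2 ≤ Real.exp Y)
    (hM₁ : ∀ μ ∈ M₁, μ.degree = 2 * D) (hM₂ : ∀ μ ∈ M₂, μ.degree = 2 * D)
    (σ : PhiCol D M₁ M₂ ≃ PhiRow D) {P Q : CX} (hP : P ∈ bodyC D T ξ η Y U)
    (hQ : Q ∈ bodyC D T ξ η Y U) :
    ∀ R ∈ bodyC D T ξ η Y U, ‖royPhi D M₁ M₂ σ ![P, Q, R]‖ ≤ Real.exp (-(T * U)) *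
      ((Fintype.card (PhiRow D)).factorial * (3 * Real.exp Y) ^ Fintype.card (PhiRow D)) := by
  intro R hR
  refine prop_6_1 hη hTL hLD hU hY hM₁ hM₂ σ (Ps := ![P, Q, R]) ?_ ?_ ?_
  · intro j; fin_cases j <;> [exact hP.1; exact hQ.1; exact hR.1]
  · intro j; fin_cases j <;> [exact hP.2.1; exact hQ.2.1; exact hR.2.1]
  · intro j; fin_cases j <;> [exact hP.2.2; exact hQ.2.2; exact hR.2.2]

/-- Homogeneity of an integer form from that of its complexification. [folklore] -/
theorem isHomogeneous_int_of_map {Pz : MvPolynomial (Fin 3) ℤ} {n : ℕ}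
    (h : (map (Int.castRingHom ℂ) Pz).IsHomogeneous n) : Pz.IsHomogeneous n := by
  intro d hd
  apply h
  rw [coeff_map]
  exact (map_ne_zero_iff (Int.castRingHom ℂ) (RingHom.injective_int _)).mpr hd

/-! ### Step 2 at one degree -/

variable {Pt : MvPolynomial (Fin 3) ℤ}

/-- **Roy 2013, Step 2 at the degree `D`** (Proposition 6.2 for `Φ` and orbits, level form). For
the data `𝓛 : LevelPkg D P̃` of the degree, a normal number field `K` containing the coordinates,
and Roy's convex body `𝒞` containing `P̃` and `Q`: if `ε := 2^{2k2^k} e^{−TU} N!(3e^Y)^N < 1`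
(`D² ≤ 2^k`), there is an orbit `O` of the configuration such that every family `(R_j)_{j∈O}` of
elements of `𝒞` satisfies `∏_{j∈O} (|R_j(α_j)|/‖α_j‖^D · e^{D h_j}) ≤ ε^{w_O/B_w}`.
[cite: Roy2013, Proposition 6.2 and §7, Step 2] -/
theorem step2_level (hη : η ≠ 0) (𝓛 : LevelPkg D Pt) {K : IntermediateField ℚ ℂ} [Normal ℚ K]
    [NumberField K] (hK : ∀ i k, 𝓛.α i k ∈ K) (hD : 1 ≤ D)
    {L : ℕ} (hTL : T ≤ (L + 2).choose 2) (hLD : L ≤ D) (hU : 0 ≤ U)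
    (hYc : (3 * (1 + ‖ξ‖ + ‖η‖⁻¹)) ^ L * (4 * (L + 1) : ℝ) ^ (L + 2).choose 2 ≤ Real.exp Y)
    (hY : 0 < Y) (hP : map (Int.castRingHom ℂ) Pt ∈ bodyC D T ξ η Y U)
    (hQ : 𝓛.Qc ∈ bodyC D T ξ η Y U)
    (k : ℕ) (hk : D ^ 2 ≤ 2 ^ k)
    (hε1 : (2 : ℝ) ^ (2 * k * 2 ^ k) * (Real.exp (-(T * U)) *
      ((Fintype.card (PhiRow D)).factorial * (3 * Real.exp Y) ^ Fintype.card (PhiRow D))) < 1) :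
    ∃ i₀ : Fin 𝓛.m, ∀ t : Fin 𝓛.m → CX, (∀ j ∈ (𝓛.cfg K hK).orb i₀, t j ∈ bodyC D T ξ η Y U) →
      ∏ j ∈ (𝓛.cfg K hK).orb i₀, (‖eval ((𝓛.cfg K hK).α j) (t j)‖ / ‖(𝓛.cfg K hK).α j‖ ^ D *
        Real.exp (D * hgtK (𝓛.cfg K hK) j)) ≤
        ((2 : ℝ) ^ (2 * k * 2 ^ k) * (Real.exp (-(T * U)) *
          ((Fintype.card (PhiRow D)).factorial * (3 * Real.exp Y) ^ Fintype.card (PhiRow D)))) ^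
          ((∑ j ∈ (𝓛.cfg K hK).orb i₀, (Y + D * hgtK (𝓛.cfg K hK) j)) /
            ∑ j, (𝓛.e j : ℝ) * (Y + D * hgtK (𝓛.cfg K hK) j)) := by
  have hB := norm_royPhi_le_of_mem_bodyC hη hTL hLD hU hYc 𝓛.hM₁ 𝓛.hM₂ 𝓛.σ hP hQ
  have hε0 : 0 < (2 : ℝ) ^ (2 * k * 2 ^ k) * (Real.exp (-(T * U)) *
      ((Fintype.card (PhiRow D)).factorial * (3 * Real.exp Y) ^ Fintype.card (PhiRow D))) :=
    mul_pos (pow_pos two_pos _) (mul_pos (Real.exp_pos _) (mul_pos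
      (by exact_mod_cast Nat.factorial_pos _) (pow_pos (mul_pos three_pos (Real.exp_pos _)) _)))
  have hsum : ∑ i, 𝓛.e i ≤ 2 ^ k := by rw [𝓛.hesum, 𝓛.hcard]; exact hk
  have hF₀ : map (Int.castRingHom ℂ) (royF D 𝓛.M₁ 𝓛.M₂ 𝓛.σ Pt (levelQ D Pt 𝓛.t)) =
      royF D 𝓛.M₁ 𝓛.M₂ 𝓛.σ (map (Int.castRingHom ℂ) Pt) (map (Int.castRingHom ℂ) (levelQ D Pt 𝓛.t)) :=
    map_royF 𝓛.σ (Int.castRingHom ℂ) Pt (levelQ D Pt 𝓛.t)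
  exact step2_select (𝓛.cfg K hK) 𝓛.hM₁ 𝓛.hM₂ 𝓛.σ hF₀ 𝓛.hc 𝓛.he1 𝓛.hFeq 𝓛.hemax
    bodyC_convex ⟨0, zero_mem_bodyC⟩ (fun R hR => hR.1) hB k hsum hε0 hε1 hY (𝓛.m_pos hD)

/-- **Integer forms of `𝒞` vanish on the selected orbit** (the conclusion
"`Z ⊆ 𝒵(𝒟ⁱP̃_D ; 0 ≤ i < 2T)`" of Proposition 6.2, in the form: any `P ∈ ℤ[X]_D` whose
complexification lies in `𝒞` vanishes at every point of `O`).
[cite: Roy2013, Proposition 6.2 and §7, Step 2] -/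
theorem vanish_on_orbit (𝓛 : LevelPkg D Pt) {K : IntermediateField ℚ ℂ} [Normal ℚ K]
    [NumberField K] (hK : ∀ i k, 𝓛.α i k ∈ K) {θ : ℝ} (hθ0 : 0 < θ) (hθ1 : θ < 1) (hY : 0 < Y)
    {i₀ : Fin 𝓛.m}
    (hO : ∀ t : Fin 𝓛.m → CX, (∀ j ∈ (𝓛.cfg K hK).orb i₀, t j ∈ bodyC D T ξ η Y U) →
      ∏ j ∈ (𝓛.cfg K hK).orb i₀, (‖eval ((𝓛.cfg K hK).α j) (t j)‖ / ‖(𝓛.cfg K hK).α j‖ ^ D *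
        Real.exp (D * hgtK (𝓛.cfg K hK) j)) ≤
        θ ^ ((∑ j ∈ (𝓛.cfg K hK).orb i₀, (Y + D * hgtK (𝓛.cfg K hK) j)) /
            ∑ j, (𝓛.e j : ℝ) * (Y + D * hgtK (𝓛.cfg K hK) j)))
    {Pz : MvPolynomial (Fin 3) ℤ} (hPz : map (Int.castRingHom ℂ) Pz ∈ bodyC D T ξ η Y U) :
    ∀ j ∈ (𝓛.cfg K hK).orb i₀, eval ((𝓛.cfg K hK).α j) (map (Int.castRingHom ℂ) Pz) = 0 := by
  classical
  have h := hO (fun _ => map (Int.castRingHom ℂ) Pz) (fun j _ => hPz)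
  -- the exponent is positive, so the bound is `< 1`
  have hw : 0 < (∑ j ∈ (𝓛.cfg K hK).orb i₀, (Y + D * hgtK (𝓛.cfg K hK) j)) /
      ∑ j, (𝓛.e j : ℝ) * (Y + D * hgtK (𝓛.cfg K hK) j) := by
    refine div_pos (Finset.sum_pos (fun j _ => ?_) ⟨i₀, (𝓛.cfg K hK).self_mem_orb i₀⟩)
      (Finset.sum_pos (fun j _ => mul_pos (by exact_mod_cast 𝓛.he1 j) ?_) ⟨i₀, mem_univ _⟩)
    · have := hgtK_nonneg (𝓛.cfg K hK) j; positivity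
    · have := hgtK_nonneg (𝓛.cfg K hK) j; positivity
  have hlt : θ ^ ((∑ j ∈ (𝓛.cfg K hK).orb i₀, (Y + D * hgtK (𝓛.cfg K hK) j)) /
      ∑ j, (𝓛.e j : ℝ) * (Y + D * hgtK (𝓛.cfg K hK) j)) < 1 :=
    Real.rpow_lt_one hθ0.le hθ1 hw
  exact step2_vanish (𝓛.cfg K hK) (isHomogeneous_int_of_map hPz.1) i₀ hlt h


open Nesterenko

/-! ### The constants of Proposition 4.5 -/

/-- The common factor `3 (3(1+|ξ|+|η|⁻¹)c₂)^T (16T³)^T` of Prop. 4.5. [cite: Roy2013, Proposition 4.5] -/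
def C45base (ξ η : ℂ) (T : ℕ) : ℝ :=
  3 * (3 * (1 + ‖ξ‖ + ‖η‖⁻¹) * max 1 (max ‖ξ‖ ‖η‖)) ^ T * (16 * (T : ℝ) ^ 3) ^ T

/-- The constant of Prop. 4.5 (i). [cite: Roy2013, Proposition 4.5 (i)] -/
def C45i (ξ η : ℂ) (T k : ℕ) : ℝ := 2 ^ T * C45base ξ η T ^ k

/-- The first constant of Prop. 4.5 (ii). [cite: Roy2013, Proposition 4.5 (ii)] -/
def C45ii (ξ η : ℂ) (T k : ℕ) : ℝ :=
  (2 * roy_c2 ξ η) ^ T * (1 + roy_c2 ξ η * Real.exp (1 + roy_c2 ξ η)) * C45base ξ η T ^ k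

/-- The second constant of Prop. 4.5 (ii). [cite: Roy2013, Proposition 4.5 (ii)] -/
def C45iii (ξ η : ℂ) (T : ℕ) : ℝ :=
  roy_c2 ξ η * Real.exp (roy_c2 ξ η) * (2 * roy_c2 ξ η ^ 2) ^ T

/-- `C45base ≥ 1` (`T ≥ 1`). [folklore] -/
theorem one_le_C45base (ξ η : ℂ) {T : ℕ} (hT : 1 ≤ T) : 1 ≤ C45base ξ η T := by
  rw [C45base]
  have hY : (1 : ℝ) ≤ 3 * (1 + ‖ξ‖ + ‖η‖⁻¹) * max 1 (max ‖ξ‖ ‖η‖) := by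
    have h1 : (1 : ℝ) ≤ max 1 (max ‖ξ‖ ‖η‖) := le_max_left _ _
    have h2 : (1 : ℝ) ≤ 1 + ‖ξ‖ + ‖η‖⁻¹ := by
      have : (0 : ℝ) ≤ ‖ξ‖ := norm_nonneg _
      have : (0 : ℝ) ≤ ‖η‖⁻¹ := inv_nonneg.mpr (norm_nonneg _)
      linarith
    nlinarith
  have hZ : (1 : ℝ) ≤ 16 * (T : ℝ) ^ 3 := by
    have h1 : (1 : ℝ) ≤ T := by exact_mod_cast hT
    have h2 : (1 : ℝ) ≤ (T : ℝ) ^ 3 := one_le_pow₀ h1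
    linarith
  have h3 : (1 : ℝ) ≤ (3 * (1 + ‖ξ‖ + ‖η‖⁻¹) * max 1 (max ‖ξ‖ ‖η‖)) ^ T := one_le_pow₀ hY
  have h4 : (1 : ℝ) ≤ (16 * (T : ℝ) ^ 3) ^ T := one_le_pow₀ hZ
  nlinarith

/-- `C45i ≥ 1`. [folklore] -/
theorem one_le_C45i (ξ η : ℂ) {T : ℕ} (hT : 1 ≤ T) (k : ℕ) : 1 ≤ C45i ξ η T k := by
  rw [C45i]
  have h1 : (1 : ℝ) ≤ 2 ^ T := one_le_pow₀ (by norm_num)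
  have h2 : (1 : ℝ) ≤ C45base ξ η T ^ k := one_le_pow₀ (one_le_C45base ξ η hT)
  nlinarith

/-- `C45ii ≥ 1`. [folklore] -/
theorem one_le_C45ii (ξ η : ℂ) {T : ℕ} (hT : 1 ≤ T) (k : ℕ) : 1 ≤ C45ii ξ η T k := by
  rw [C45ii]
  have hc := one_le_roy_c2 ξ η
  have h1 : (1 : ℝ) ≤ (2 * roy_c2 ξ η) ^ T := one_le_pow₀ (by linarith)
  have h1' : (1 : ℝ) ≤ 1 + roy_c2 ξ η * Real.exp (1 + roy_c2 ξ η) := by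
    have := Real.exp_pos (1 + roy_c2 ξ η); nlinarith
  have h2 : (1 : ℝ) ≤ C45base ξ η T ^ k := one_le_pow₀ (one_le_C45base ξ η hT)
  have h3 : (1 : ℝ) ≤ (2 * roy_c2 ξ η) ^ T * (1 + roy_c2 ξ η * Real.exp (1 + roy_c2 ξ η)) := by
    nlinarith
  nlinarith

/-- `C45iii ≥ 1`. [folklore] -/
theorem one_le_C45iii (ξ η : ℂ) (T : ℕ) : 1 ≤ C45iii ξ η T := by
  rw [C45iii]
  have hc := one_le_roy_c2 ξ η
  have h1 : (1 : ℝ) ≤ Real.exp (roy_c2 ξ η) := Real.one_le_exp (by linarith)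
  have h2 : (1 : ℝ) ≤ (2 * roy_c2 ξ η ^ 2) ^ T := one_le_pow₀ (by nlinarith)
  have h3 : (1 : ℝ) ≤ roy_c2 ξ η * Real.exp (roy_c2 ξ η) := by nlinarith
  nlinarith

/-! ### Normalising an element of `I^{(γ,T)}` into `𝒞` -/

variable {D T : ℕ} {ξ η : ℂ} {Y U : ℝ}

/-- A non-zero form of `I_D^{(γ,T)}`, divided by its norm, lies in `𝒞` (if `Y ≥ 0`), and its values
scale accordingly. [cite: Roy2013, §7, Step 2 ("`sup{|P(α)| ; P ∈ I_D^{(γ,T)}, ‖P‖ ≤ 1}`")] -/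
theorem smul_mem_bodyC_of_mem_vanIdeal (hY : 0 ≤ Y) {P : CX} (hP : P.IsHomogeneous D)
    (hPv : P ∈ vanIdeal ξ η T) (hP0 : P ≠ 0) :
    ((maxNorm P)⁻¹ : ℂ) • P ∈ bodyC D T ξ η Y U ∧
      ∀ α : Fin 3 → ℂ, ‖aeval α (((maxNorm P)⁻¹ : ℂ) • P)‖ = (maxNorm P)⁻¹ * ‖aeval α P‖ := by
  have hm : 0 < maxNorm P := maxNorm_pos hP0
  refine ⟨⟨?_, ?_, fun i hi => ?_⟩, fun α => ?_⟩
  · rw [smul_eq_C_mul]; simpa using (isHomogeneous_C _ _).mul hP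
  · rw [smul_eq_C_mul]
    refine (maxNorm_C_mul_le _ _).trans ?_
    rw [norm_inv, Complex.norm_real, Real.norm_of_nonneg hm.le, inv_mul_cancel₀ hm.ne']
    exact Real.one_le_exp hY
  · have h1 : ((maxNorm P)⁻¹ : ℂ) • P ∈ vanIdeal ξ η T := by
      rw [smul_eq_C_mul]; exact Ideal.mul_mem_left _ _ hPv
    rw [(mem_vanIdeal_iff.mp h1) i hi, norm_zero]
    exact (Real.exp_pos _).le
  · rw [map_smul, norm_smul, norm_inv, Complex.norm_real, Real.norm_of_nonneg hm.le]

/-! ### The test forms -/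

/-- **Test form controlled by `dist(α, (1:γ))`** (any `α` of sup norm `≤ 1`): there is `t ∈ 𝒞`
with `dist(α,(1:γ))^T ≤ C₁ |t(α)|`. [cite: Roy2013, §7, Step 2 (points of `Z ∖ 𝒰`), Prop. 4.5 (i)] -/
theorem exists_testForm_pdist (hη : η ≠ 0) {L k : ℕ} (hT₁ : (L + 1).choose 2 < T)
    (hT₂ : T ≤ (L + 2).choose 2) (hD : 3 * (L + 1) ≤ D) (hDT : D ≤ T)
    (hk : 2 ^ k * T ≤ 3 ^ k * D) (hY : 0 ≤ Y) {α : Fin 3 → ℂ} (hα : ∀ i, ‖α i‖ ≤ 1) :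
    ∃ t ∈ bodyC D T ξ η Y U, pdist ξ η α ^ T ≤ C45i ξ η T k * ‖aeval α t‖ := by
  obtain ⟨P, hP, hPv, hP0, hineq⟩ := prop_4_5_i hη hT₁ hT₂ hD hDT hk hα
  obtain ⟨hmem, hval⟩ := smul_mem_bodyC_of_mem_vanIdeal (U := U) hY hP hPv hP0
  refine ⟨_, hmem, ?_⟩
  have hm : 0 < maxNorm P := maxNorm_pos hP0
  change maxNorm P * pdist ξ η α ^ T ≤ C45i ξ η T k * ‖aeval α P‖ at hineq
  rw [hval]
  refine le_of_mul_le_mul_left ?_ hm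
  calc maxNorm P * pdist ξ η α ^ T ≤ C45i ξ η T k * ‖aeval α P‖ := hineq
    _ = maxNorm P * (C45i ξ η T k * ((maxNorm P)⁻¹ * ‖aeval α P‖)) := by field_simp

/-- **Test form controlled by `max{dist(α,(1:γ))^T, dist(α, A_γ)}`** (`α ∈ 𝒰`): there is `t ∈ 𝒞`
with `t(α) ≠ 0` and `log|t(α)| ≥ max{T log dist(α,(1:γ)), b} − E₂`, where `b = log dist(α, A_γ)`
if this distance is non-zero and `b ≤ T log dist(α,(1:γ))` otherwise, and
`E₂ = log C₁ + log C₂ + log(2 C₃) + log 2`. [cite: Roy2013, §7, Step 2 (points of `𝒰`),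
Prop. 4.5 (i), (ii)] -/
theorem exists_testForm_max (hη : η ≠ 0) {L k : ℕ} (hT₁ : (L + 1).choose 2 < T)
    (hT₂ : T ≤ (L + 2).choose 2) (hD : 3 * (L + 1) ≤ D) (hDT : D ≤ T)
    (hk : 2 ^ k * T ≤ 3 ^ k * D) (hY : 0 ≤ Y) {α : Fin 3 → ℂ} (hα : ∀ i, ‖α i‖ ≤ 1)
    (hα1 : ∃ i, 1 ≤ ‖α i‖) (hd : pdist ξ η α ≤ (2 * roy_c2 ξ η)⁻¹) (hpd : 0 < pdist ξ η α)
    {b : ℝ} (hb0 : adist ξ η α = 0 → b ≤ T * Real.log (pdist ξ η α))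
    (hb1 : adist ξ η α ≠ 0 → b = Real.log (adist ξ η α)) :
    ∃ t ∈ bodyC D T ξ η Y U, aeval α t ≠ 0 ∧
      max (T * Real.log (pdist ξ η α)) b -
        (Real.log (C45i ξ η T k) + Real.log (C45ii ξ η T k) + Real.log (2 * C45iii ξ η T) +
          Real.log 2) ≤ Real.log ‖aeval α t‖ := by
  have hT1 : 1 ≤ T := by
    have : 0 < T := lt_of_le_of_lt (Nat.zero_le _) hT₁
    omega
  have hα0 := lemma_4_1 hα1 hd
  have hC1 := one_le_C45i ξ η hT1 k
  have hC2 := one_le_C45ii ξ η hT1 k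
  have hC3 := one_le_C45iii ξ η T
  have hlogs : 0 ≤ Real.log (C45i ξ η T k) ∧ 0 ≤ Real.log (C45ii ξ η T k) ∧
      0 ≤ Real.log (2 * C45iii ξ η T) ∧ 0 ≤ Real.log 2 :=
    ⟨Real.log_nonneg hC1, Real.log_nonneg hC2, Real.log_nonneg (by linarith),
      Real.log_nonneg (by norm_num)⟩
  set E : ℝ := Real.log (C45i ξ η T k) + Real.log (C45ii ξ η T k) +
    Real.log (2 * C45iii ξ η T) + Real.log 2 with hE
  by_cases hcase : adist ξ η α ≤ 2 * C45iii ξ η T * pdist ξ η α ^ T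
  · -- use the form of (i)
    obtain ⟨t, ht, hineq⟩ := exists_testForm_pdist (U := U) hη hT₁ hT₂ hD hDT hk hY hα
    have hval : 0 < ‖aeval α t‖ := by
      by_contra h0
      push Not at h0
      have h1 : ‖aeval α t‖ = 0 := le_antisymm h0 (norm_nonneg _)
      rw [h1, mul_zero] at hineq
      exact absurd hineq (not_le.mpr (pow_pos hpd T))
    refine ⟨t, ht, norm_pos_iff.mp hval, ?_⟩
    -- `T log pdist ≤ log C₁ + log|t(α)|`
    have h2 : (T : ℝ) * Real.log (pdist ξ η α) ≤ Real.log (C45i ξ η T k) + Real.log ‖aeval α t‖ := by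
      rw [← Real.log_pow, ← Real.log_mul (by linarith) hval.ne']
      exact Real.log_le_log (pow_pos hpd T) hineq
    -- `b ≤ T log pdist + log (2 C₃)`
    have h3 : b ≤ T * Real.log (pdist ξ η α) + Real.log (2 * C45iii ξ η T) := by
      by_cases ha : adist ξ η α = 0
      · have := hb0 ha; linarith [hlogs.2.2.1]
      · rw [hb1 ha]
        have hapos : 0 < adist ξ η α := lt_of_le_of_ne (adist_nonneg _ _ _) (Ne.symm ha)
        calc Real.log (adist ξ η α) ≤ Real.log (2 * C45iii ξ η T * pdist ξ η α ^ T) :=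
              Real.log_le_log hapos hcase
          _ = T * Real.log (pdist ξ η α) + Real.log (2 * C45iii ξ η T) := by
              rw [Real.log_mul (by linarith) (pow_pos hpd T).ne', Real.log_pow]; ring
    have h4 : max (T * Real.log (pdist ξ η α)) b ≤
        T * Real.log (pdist ξ η α) + Real.log (2 * C45iii ξ η T) :=
      max_le (by linarith [hlogs.2.2.1]) h3
    linarith [hlogs.1, hlogs.2.1, hlogs.2.2.2]
  · -- use the form of (ii)
    push Not at hcase
    have hapos : 0 < adist ξ η α :=
      lt_of_le_of_lt (by positivity) hcase
    obtain ⟨P, hP, hPv, hP0, hineq⟩ := prop_4_5_ii hη hT₁ hT₂ hD hDT hk hα hα0 hd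
    obtain ⟨hmem, hvalP⟩ := smul_mem_bodyC_of_mem_vanIdeal (U := U) hY hP hPv hP0
    set t := ((maxNorm P)⁻¹ : ℂ) • P with htdef
    have hm : 0 < maxNorm P := maxNorm_pos hP0
    -- `adist ≤ C₂ |t(α)| + C₃ pdist^T`
    have h1 : adist ξ η α ≤ C45ii ξ η T k * ‖aeval α t‖ + C45iii ξ η T * pdist ξ η α ^ T := by
      change maxNorm P * adist ξ η α ≤
        C45ii ξ η T k * ‖aeval α P‖ + maxNorm P * (C45iii ξ η T * pdist ξ η α ^ T) at hineq
      rw [hvalP]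
      refine le_of_mul_le_mul_left ?_ hm
      calc maxNorm P * adist ξ η α
          ≤ C45ii ξ η T k * ‖aeval α P‖ + maxNorm P * (C45iii ξ η T * pdist ξ η α ^ T) := hineq
        _ = maxNorm P * (C45ii ξ η T k * ((maxNorm P)⁻¹ * ‖aeval α P‖) +
            C45iii ξ η T * pdist ξ η α ^ T) := by field_simp
    -- hence `adist / 2 ≤ C₂ |t(α)|`
    have h3 : adist ξ η α / 2 ≤ C45ii ξ η T k * ‖aeval α t‖ := by nlinarith
    have hval : 0 < ‖aeval α t‖ := by
      by_contra h0; push Not at h0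
      have : ‖aeval α t‖ = 0 := le_antisymm h0 (norm_nonneg _)
      rw [this, mul_zero] at h3
      linarith
    refine ⟨t, hmem, norm_pos_iff.mp hval, ?_⟩
    have h5 : Real.log (adist ξ η α) ≤ Real.log 2 + Real.log (C45ii ξ η T k) + Real.log ‖aeval α t‖ := by
      have h6 : adist ξ η α ≤ 2 * (C45ii ξ η T k * ‖aeval α t‖) := by linarith
      calc Real.log (adist ξ η α) ≤ Real.log (2 * (C45ii ξ η T k * ‖aeval α t‖)) :=
            Real.log_le_log hapos h6
        _ = _ := by rw [Real.log_mul (by norm_num) (by positivity), Real.log_mul (by linarith) hval.ne']; ring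
    -- `T log pdist < log adist` in this case
    have h7 : T * Real.log (pdist ξ η α) ≤ Real.log (adist ξ η α) := by
      have h8 : pdist ξ η α ^ T ≤ adist ξ η α := by
        have h9 : pdist ξ η α ^ T ≤ 2 * C45iii ξ η T * pdist ξ η α ^ T := by
          have := pow_pos hpd T; nlinarith
        linarith
      rw [← Real.log_pow]
      exact Real.log_le_log (pow_pos hpd T) h8
    have h4 : max (T * Real.log (pdist ξ η α)) b ≤ Real.log (adist ξ η α) := by
      rw [hb1 hapos.ne']
      exact max_le h7 le_rfl
    linarith [hlogs.1, hlogs.2.2.1]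



open Nesterenko

/-! ### Unit representatives -/

/-- The representative of sup norm `1`: `α^u = α / ‖α‖`. [cite: Roy2013, §7, Step 2 ("a set of
representatives of the points of `Z(ℂ)` by elements of `ℂ³` of norm `1`")] -/
def unitRep (α : Fin 3 → ℂ) : Fin 3 → ℂ := ((‖α‖⁻¹ : ℝ) : ℂ) • α

/-- Coordinates of `α^u` have modulus `≤ 1`. [folklore] -/
theorem norm_unitRep_apply_le {α : Fin 3 → ℂ} (hα : α ≠ 0) (i : Fin 3) : ‖unitRep α i‖ ≤ 1 := by
  have h0 : 0 < ‖α‖ := norm_pos_iff.mpr hα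
  rw [unitRep, Pi.smul_apply, norm_smul, Complex.norm_real, Real.norm_of_nonneg (inv_nonneg.mpr h0.le),
    inv_mul_le_iff₀ h0, mul_one]
  exact norm_le_pi_norm α i

/-- Some coordinate of `α^u` has modulus `≥ 1`. [folklore] -/
theorem exists_one_le_norm_unitRep {α : Fin 3 → ℂ} (hα : α ≠ 0) : ∃ i, 1 ≤ ‖unitRep α i‖ := by
  have h0 : 0 < ‖α‖ := norm_pos_iff.mpr hα
  obtain ⟨i, hi⟩ := exists_pi_norm_eq_apply α
  refine ⟨i, ?_⟩
  rw [unitRep, Pi.smul_apply, norm_smul, Complex.norm_real, Real.norm_of_nonneg (inv_nonneg.mpr h0.le),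
    ← hi, inv_mul_cancel₀ h0.ne']

/-- Values of forms: `|R(α^u)| = |R(α)| / ‖α‖^D`. [folklore] -/
theorem norm_aeval_unitRep {α : Fin 3 → ℂ} (hα : α ≠ 0) {R : CX} {D : ℕ} (hR : R.IsHomogeneous D) :
    ‖aeval (unitRep α) R‖ = ‖aeval α R‖ / ‖α‖ ^ D := by
  have h0 : 0 < ‖α‖ := norm_pos_iff.mpr hα
  rw [unitRep, aeval_smul_of_isHomogeneous hR, norm_mul, norm_pow, Complex.norm_real,
    Real.norm_of_nonneg (inv_nonneg.mpr h0.le), inv_pow, div_eq_inv_mul]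

/-! ### The error term -/

/-- The error term `E` of Step 2 (Roy's `7T(log T)² `): the maximum of the losses at points of `𝒰`
and outside `𝒰`. [cite: Roy2013, §7, Step 2] -/
def errStep2 (ξ η : ℂ) (T k : ℕ) : ℝ :=
  Real.log (C45i ξ η T k) + Real.log (C45ii ξ η T k) + Real.log (2 * C45iii ξ η T) + Real.log 2 +
    T * Real.log (2 * roy_c2 ξ η)

/-- `E ≥` the loss at points of `𝒰`. [folklore] -/
theorem errU_le_errStep2 (ξ η : ℂ) (T k : ℕ) :
    Real.log (C45i ξ η T k) + Real.log (C45ii ξ η T k) + Real.log (2 * C45iii ξ η T) + Real.log 2 ≤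
      errStep2 ξ η T k := by
  rw [errStep2]
  have hc := one_le_roy_c2 ξ η
  have : 0 ≤ (T : ℝ) * Real.log (2 * roy_c2 ξ η) :=
    mul_nonneg (Nat.cast_nonneg _) (Real.log_nonneg (by linarith))
  linarith

/-- `E ≥` the loss outside `𝒰`. [folklore] -/
theorem errOut_le_errStep2 (ξ η : ℂ) {T : ℕ} (hT : 1 ≤ T) (k : ℕ) :
    T * Real.log (2 * roy_c2 ξ η) + Real.log (C45i ξ η T k) ≤ errStep2 ξ η T k := by
  rw [errStep2]
  have h1 := Real.log_nonneg (one_le_C45ii ξ η hT k)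
  have h2 : 0 ≤ Real.log (2 * C45iii ξ η T) :=
    Real.log_nonneg (by linarith [one_le_C45iii ξ η T])
  have h3 : 0 ≤ Real.log 2 := Real.log_nonneg (by norm_num)
  linarith

/-! ### The sum over `𝒰` -/

variable {K : IntermediateField ℚ ℂ} [NumberField K] {m : ℕ}

/-- **Roy 2013, Step 2 — the sum over `𝒰`.** See the module docstring.
[cite: Roy2013, §7, Step 2 (last display)] -/
theorem step2_sums (Z : ZeroConfigK K (Fin m)) {D T : ℕ} {ξ η : ℂ} {Y U : ℝ} (hη : η ≠ 0)
    {L k : ℕ} (hT₁ : (L + 1).choose 2 < T) (hT₂ : T ≤ (L + 2).choose 2) (hD : 3 * (L + 1) ≤ D)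
    (hDT : D ≤ T) (hk : 2 ^ k * T ≤ 3 ^ k * D) (hY : 0 ≤ Y) (i₀ : Fin m) {Θ : ℝ}
    (hO : ∀ t : Fin m → CX, (∀ j ∈ Z.orb i₀, t j ∈ bodyC D T ξ η Y U) →
      ∏ j ∈ Z.orb i₀, (‖eval (Z.α j) (t j)‖ / ‖Z.α j‖ ^ D * Real.exp (D * hgtK Z j)) ≤ Θ)
    (hpd : ∀ j ∈ Z.orb i₀, 0 < pdist ξ η (unitRep (Z.α j)))
    (b : Fin m → ℝ)
    (hb0 : ∀ j ∈ Z.orb i₀, pdist ξ η (unitRep (Z.α j)) ≤ (2 * roy_c2 ξ η)⁻¹ →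
      adist ξ η (unitRep (Z.α j)) = 0 → b j ≤ T * Real.log (pdist ξ η (unitRep (Z.α j))))
    (hb1 : ∀ j ∈ Z.orb i₀, pdist ξ η (unitRep (Z.α j)) ≤ (2 * roy_c2 ξ η)⁻¹ →
      adist ξ η (unitRep (Z.α j)) ≠ 0 → b j = Real.log (adist ξ η (unitRep (Z.α j)))) :
    ∑ j ∈ (Z.orb i₀).filter (fun j => pdist ξ η (unitRep (Z.α j)) ≤ (2 * roy_c2 ξ η)⁻¹),
        max (T * Real.log (pdist ξ η (unitRep (Z.α j)))) (b j) ≤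
      Real.log Θ + errStep2 ξ η T k * (Z.orb i₀).card := by
  classical
  have hT1 : 1 ≤ T := by have := Nat.zero_le ((L + 1).choose 2); omega
  set O := Z.orb i₀ with hOdef
  set p : Fin m → Prop := fun j => pdist ξ η (unitRep (Z.α j)) ≤ (2 * roy_c2 ξ η)⁻¹ with hp
  have hαu : ∀ j, ∀ i, ‖unitRep (Z.α j) i‖ ≤ 1 := fun j => norm_unitRep_apply_le (Z.α_ne_zero j)
  have hαu1 : ∀ j, ∃ i, 1 ≤ ‖unitRep (Z.α j) i‖ := fun j => exists_one_le_norm_unitRep (Z.α_ne_zero j)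
  -- the test forms, point by point
  have hex : ∀ j, ∃ t : CX, j ∈ O → t ∈ bodyC D T ξ η Y U ∧ 0 < ‖aeval (unitRep (Z.α j)) t‖ ∧
      (p j → max (T * Real.log (pdist ξ η (unitRep (Z.α j)))) (b j) - errStep2 ξ η T k ≤
        Real.log ‖aeval (unitRep (Z.α j)) t‖) ∧
      (¬p j → -errStep2 ξ η T k ≤ Real.log ‖aeval (unitRep (Z.α j)) t‖) := by
    intro j
    by_cases hj : j ∈ O
    · by_cases hpj : p j
      · obtain ⟨t, ht, ht0, hineq⟩ := exists_testForm_max (U := U) hη hT₁ hT₂ hD hDT hk hY (hαu j)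
          (hαu1 j) hpj (hpd j hj) (hb0 j hj hpj) (hb1 j hj hpj)
        refine ⟨t, fun _ => ⟨ht, norm_pos_iff.mpr ht0, fun _ => ?_, fun h => absurd hpj h⟩⟩
        linarith [errU_le_errStep2 ξ η T k]
      · obtain ⟨t, ht, hineq⟩ := exists_testForm_pdist (U := U) hη hT₁ hT₂ hD hDT hk hY (hαu j)
        have hpos : 0 < ‖aeval (unitRep (Z.α j)) t‖ := by
          by_contra h0; push Not at h0
          have h1 : ‖aeval (unitRep (Z.α j)) t‖ = 0 := le_antisymm h0 (norm_nonneg _)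
          rw [h1, mul_zero] at hineq
          exact absurd hineq (not_le.mpr (pow_pos (hpd j hj) T))
        refine ⟨t, fun _ => ⟨ht, hpos, fun h => absurd h hpj, fun _ => ?_⟩⟩
        -- `pdist > (2c₂)⁻¹`, so `T log pdist − log C₁ ≥ −E`
        have hc := one_le_roy_c2 ξ η
        have h2 : (T : ℝ) * Real.log (pdist ξ η (unitRep (Z.α j))) ≤
            Real.log (C45i ξ η T k) + Real.log ‖aeval (unitRep (Z.α j)) t‖ := by
          rw [← Real.log_pow, ← Real.log_mul (by linarith [one_le_C45i ξ η hT1 k]) hpos.ne']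
          exact Real.log_le_log (pow_pos (hpd j hj) T) hineq
        have h3 : -Real.log (2 * roy_c2 ξ η) ≤ Real.log (pdist ξ η (unitRep (Z.α j))) := by
          rw [← Real.log_inv]
          exact Real.log_le_log (by positivity) (le_of_lt (not_le.mp hpj))
        have h4 : -((T : ℝ) * Real.log (2 * roy_c2 ξ η)) ≤ T * Real.log (pdist ξ η (unitRep (Z.α j))) := by
          rw [← mul_neg]; exact mul_le_mul_of_nonneg_left h3 (Nat.cast_nonneg _)
        linarith [errOut_le_errStep2 ξ η hT1 k]
    · exact ⟨0, fun h => absurd h hj⟩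
  choose t ht using hex
  -- the product inequality for this family, in logarithmic form
  have htC : ∀ j ∈ O, t j ∈ bodyC D T ξ η Y U := fun j hj => (ht j hj).1
  have hprod := hO t htC
  have hfac : ∀ j ∈ O, ‖eval (Z.α j) (t j)‖ / ‖Z.α j‖ ^ D = ‖aeval (unitRep (Z.α j)) (t j)‖ := by
    intro j hj
    rw [norm_aeval_unitRep (Z.α_ne_zero j) (htC j hj).1]
    rfl
  have hpos : ∀ j ∈ O, 0 < ‖eval (Z.α j) (t j)‖ / ‖Z.α j‖ ^ D * Real.exp (D * hgtK Z j) := by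
    intro j hj
    rw [hfac j hj]
    exact mul_pos (ht j hj).2.1 (Real.exp_pos _)
  have hlog : ∑ j ∈ O, (Real.log ‖aeval (unitRep (Z.α j)) (t j)‖ + D * hgtK Z j) ≤ Real.log Θ := by
    have h1 := Real.log_le_log (prod_pos hpos) hprod
    rw [Real.log_prod (fun j hj => (hpos j hj).ne')] at h1
    refine le_trans (le_of_eq (Finset.sum_congr rfl fun j hj => ?_)) h1
    rw [hfac j hj, Real.log_mul (ht j hj).2.1.ne' (Real.exp_pos _).ne', Real.log_exp]
  have hf : ∑ j ∈ O, Real.log ‖aeval (unitRep (Z.α j)) (t j)‖ ≤ Real.log Θ := by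
    refine le_trans (Finset.sum_le_sum fun j _ => ?_) hlog
    have := hgtK_nonneg Z j
    have : (0 : ℝ) ≤ D * hgtK Z j := by positivity
    linarith
  -- putting all these estimates together
  have hglue := sum_filter_le_sum_add O p (fun j => Real.log ‖aeval (unitRep (Z.α j)) (t j)‖)
    (fun j => max (T * Real.log (pdist ξ η (unitRep (Z.α j)))) (b j)) (errStep2 ξ η T k)
    (fun j hj hpj => by linarith [(ht j hj).2.2.1 hpj])
    (fun j hj hpj => by linarith [(ht j hj).2.2.2 hpj])
  linarith


end Roy2013

end Literature.NumberTheory.Transcendental
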